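/-
Fleet lead `ym-wcr-19609-p1` (seat prover-ym-wcr-19609-p1-g2-0), route `WeakCouplingRates`, crux `BulkDominatesColdBoxW`
(stmt-QuantumFields-19609), line `dlr-chessboard` (skeleton v7 `edb15e5f1be64c2e`): registered stub `stub_boxPolyFloor`, BY NAME.
-/
import Summits.QuantumFields.YangMills.Theorems.WeakCouplingRatesBulkDominatesColdBoxWBoxPolyFloorOfBox
import Summits.QuantumFields.YangMills.Theorems.WeakCouplingRatesColdBoxTwoPointFloorW
import Summits.QuantumFields.YangMills.Theorems.WeakCouplingRatesCurvatureCorrPowerFloor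

/-!
# Crux `BulkDominatesColdBoxW`, line `dlr-chessboard`: the registered stub `stub_boxPolyFloor` — CLOSED

`stub_boxPolyFloor : ∃ θ₁ > 0, ∀ θ, 0 < θ → θ ≤ θ₁ → BoxPolyFloor (θ/20) θ (2 + θ/2)` (skeleton v7 of crux stmt-QuantumFields-19609) follows from the two
sibling cruxes of the route, both PROVED in the tree: BOX_W `ColdBoxTwoPointFloorW_proof` (`…ColdBoxTwoPointFloorW`) and FLOOR
`curvatureCorrPowerFloor_proof` (`…CurvatureCorrPowerFloor`), through the reduction `boxPolyFloor_of_box_floor` (`…BoxPolyFloorOfBox`, p448845).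
No new definition; standard axioms.  NOT a claim about the mass gap.
-/

set_option autoImplicit false

noncomputable section

namespace Summit.QuantumFields.YangMills.Theorems.WeakCouplingRates

/-- **Registered stub `stub_boxPolyFloor` of crux `BulkDominatesColdBoxW` (line dlr-chessboard, v7)**: the polynomial floor of the cold-wall box
two-point function along `(A, K) = (θ/20, 2 + θ/2)`, for all small `θ`. -/
theorem stub_boxPolyFloor : ∃ θ₁ : ℝ, 0 < θ₁ ∧ ∀ θ : ℝ, 0 < θ → θ ≤ θ₁ → BoxPolyFloor (θ / 20) θ (2 + θ / 2) :=
  boxPolyFloor_of_box_floor ColdBoxTwoPointFloorW_proof curvatureCorrPowerFloor_proof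

end Summit.QuantumFields.YangMills.Theorems.WeakCouplingRates

end
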